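/-
Copyright: the b2b-balaban T⁴-continuum CRUX team, row NE7b OWNER lineage `t4-ne7b-p1` (gen 136). Project licence.
-/
import Summits.QuantumFields.BalabanUV.T4Continuum.Spine.NE7b.SupBlockEffectiveActionCovariance
import Summits.QuantumFields.BalabanUV.T4Continuum.Spine.NE7b.SupNextHessianMatrix

/-!
# THE EXTRACTED QUADRATIC AND LINEAR PARTS OF A BLOCK-LOCAL INPUT ARE AN HONEST MATRIX AND VECTOR — (388)'s BLOCK TWIN: for a `C²`
# block potential `U` with the three block letters, at every background `ψ₀` the Hessian of (402) is represented by the symmetric MATRIX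
# `K_D(ψ₀)(x,y) = ½(Hess[e_x,e_y] + Hess[e_y,e_x])` (`vᵀK_Du = ` the covariance formula of (403), by (388)'s `symmMatrix_form_eq`), the
# gradient of (399) by the VECTOR `b_D(ψ₀)(x) = D(−log Z)(ψ₀)[e_x]` (`⟨b_D,v⟩ = Z⁻¹∫e^{−U}U′(ω+ψ₀)[v]`), and (403)'s Hessian letters become
# the MATRIX LETTERS   `K_D + 2λ·1 ⪰ 0` (over `N(0,M⁻¹)`, `2λ ≤ m`)   and   `Λ·1 − K_D ⪰ 0`
# — the inputs `K`, `b`, `k = 2λ` of (385)∕(387)∕(390)–(395) for a BLOCK-local input, so THE DRESSED STEP RUNS ON BLOCK-LOCAL INPUTS with the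
# same letters (row NE7b, node U5c; (388)∕(399)∕(402)∕(403) BY NAME; [folklore])

Cell `pub-balaban`, sub-cell `t4`, spine estimate NE7b (`T4WeightBudget.RelWeightBound`; the cell's OWN estimate — NOT PRINTED in
[Bałaban 1983–89], NOT PROVED).  Crux-route work under `Spine/NE7b/` by the row OWNER (`t4-ne7b-p1` gen 136, file (404)) under FREEZE
(0)'s crux-prover clause, on this gen's SCOPING-d8 DECISION (d8′); NOTHING of Bałaban's is named as a Lean object, valued or asserted; no
`T4Continuum/Support` leaf typed; no `def`, no notation (the matrix and the vector WRITTEN OUT); zero `sorry`.  Imports (BY NAME): the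
OWNER's (403) `…SupBlockEffectiveActionCovariance` (`hessian_block_neg_log_apply`, `hessian_block_neg_log_ge`, `hessian_block_neg_log_le`),
(388) `…SupNextHessianMatrix` (`clm₁_apply_eq_dot`, `symmMatrix_form_eq`, `symmMatrix_isHermitian`, `letters_of_form_bounds`), and through
them (399) (`fderiv_block_neg_log_apply`).

WHAT IS PROVED ([folklore]):
* §1 `sum_sq_le_dotSelf` (`Σ_Yv² ≤ v·v`), `sum_sq_univ_eq_dotSelf` (`Σ_iv_i² = v·v`);
* §2 **`blockGradient_apply`** (`⟨b_D(ψ₀),v⟩ = Z⁻¹∫e^{−U(ω+ψ₀)}U′(ω+ψ₀)[v]dN(0,Γ)`), **`blockHessianMatrix_apply`** (`vᵀK_D(ψ₀)v =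
  Z⁻¹∫e^{−U}(U″[v,v] − U′[v]²) + Z⁻²(∫e^{−U}U′[v])²`, the covariance formula), **`blockHessianMatrix_letters`** (THE END: `K_D` symmetric,
  `K_D + 2λ·1 ⪰ 0`, `Λ·1 − K_D ⪰ 0` over `N(0,M⁻¹)` under (403)'s hypotheses with `0 ≤ Λ`); §3 toy.

HONEST (what this is NOT).  Linear algebra over (399)∕(402)∕(403); the cubic column for block inputs ((337b)–(339)'s twins) remains; scalar
skeleton ((A3), NC-NE7b-α UNRULED); nothing of Bałaban's asserted.  BY-NAME EFFECT ON THE WALL: NONE.  NE7b NOT PRINTED ∕ NOT PROVED; spine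
PROVED 0∕9; rung (B)+1 — the programme's measures remain FINITE-torus statements; NOT the mass gap, NOT Clay.  HONEST DEPENDENCY: continuum YM
on T⁴ ⇐ BetaPertH ∧ nine spine estimates (0∕9 proved); BetaPertH ⇐ (D1) ∧ (D4) ∧ CAP+tail; G-an2-4 gates asym, D1 and NE2∕3∕4.
-/

set_option autoImplicit false
set_option maxSynthPendingDepth 2

noncomputable section

namespace Summit.QuantumFields.BalabanUV.T4Continuum.NE7b.SupBlockNextHessianMatrix

open MeasureTheory ProbabilityTheory Finset Real Matrix
open scoped BigOperators
open SupBlockEffectiveActionCovariance (hessian_block_neg_log_apply hessian_block_neg_log_ge hessian_block_neg_log_le)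
open SupNextHessianMatrix (clm₁_apply_eq_dot symmMatrix_form_eq symmMatrix_isHermitian letters_of_form_bounds)
open SupBlockEffectiveActionDerivative (fderiv_block_neg_log_apply)

variable {ι : Type} [Fintype ι] [DecidableEq ι]

/-! ## §1. Two sums against the dot product -/

omit [DecidableEq ι] in
/-- `Σ_{x∈Y}v_x² ≤ v·v`. [folklore] -/
theorem sum_sq_le_dotSelf (Y : Finset ι) (v : ι → ℝ) : ∑ x ∈ Y, v x ^ 2 ≤ v ⬝ᵥ v := by
  have e : v ⬝ᵥ v = ∑ x, v x ^ 2 := by simp only [dotProduct, pow_two]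
  rw [e]
  exact Finset.sum_le_univ_sum_of_nonneg fun x => sq_nonneg (v x)

omit [DecidableEq ι] in
/-- `Σ_iv_i² = v·v`. [folklore] -/
theorem sum_sq_univ_eq_dotSelf (v : ι → ℝ) : ∑ x, v x ^ 2 = v ⬝ᵥ v := by
  simp only [dotProduct, pow_two]

/-! ## §2. THE ROAD: `b_D(ψ₀)` and `K_D(ψ₀)` for a block-local input -/

section Road

variable {Γ : Matrix ι ι ℝ} {γop : ℝ} {U : EuclideanSpace ℝ ι → ℝ} {U' : EuclideanSpace ℝ ι → EuclideanSpace ℝ ι →L[ℝ] ℝ}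
  {U'' : EuclideanSpace ℝ ι → EuclideanSpace ℝ ι →L[ℝ] EuclideanSpace ℝ ι →L[ℝ] ℝ} {κ₀ κ₁ κ₂ a τ δ θ : ℝ}

/-- **THE EXTRACTED LINEAR PART OF A BLOCK INPUT IS THE VECTOR `b_D(ψ₀)(x) = D(−log Z)(ψ₀)[e_x]`**: under (399)'s hypotheses, for every
direction `v`, `⟨b_D(ψ₀), v⟩ = Z(ψ₀)⁻¹·∫e^{−U(ω+ψ₀)}U′(ω+ψ₀)[v] dN(0,Γ)`. [folklore] -/
theorem blockGradient_apply (hΓ : Γ.PosSemidef) (hΓop : (γop • (1 : Matrix ι ι ℝ) - Γ).PosSemidef) (Y : Finset ι)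
    (hUd : ∀ φ : EuclideanSpace ℝ ι, HasFDerivAt U (U' φ) φ) (hU'c : Continuous U')
    (hκ₀ : 0 ≤ κ₀) (hκ₁ : 0 ≤ κ₁) (ha : 0 ≤ a) (hτ : 0 < τ) (hδ : 0 < δ) (hθ1 : θ < 1)
    (hκθ : (2 * κ₀ * (1 + τ) + 4 * δ) * γop ≤ θ) (hstab : ∀ φ : EuclideanSpace ℝ ι, -(κ₀ * ∑ x ∈ Y, φ x ^ 2) ≤ U φ)
    (hU'b : ∀ φ : EuclideanSpace ℝ ι, ‖U' φ‖ ≤ κ₁ * (a + ∑ x ∈ Y, φ x ^ 2)) (ψ₀ v : EuclideanSpace ℝ ι) :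
    (fun x : ι => ((∫ ω : EuclideanSpace ℝ ι, exp (-U (ω + ψ₀)) ∂(multivariateGaussian 0 Γ))⁻¹ • ∫ ω : EuclideanSpace ℝ ι, exp (-U (ω + ψ₀)) • U' (ω +
      ψ₀) ∂(multivariateGaussian 0 Γ)) (EuclideanSpace.single x (1 : ℝ))) ⬝ᵥ (WithLp.ofLp v) =
      (∫ ω : EuclideanSpace ℝ ι, exp (-U (ω + ψ₀)) ∂(multivariateGaussian 0 Γ))⁻¹ *
        ∫ ω : EuclideanSpace ℝ ι, exp (-U (ω + ψ₀)) * U' (ω + ψ₀) v ∂(multivariateGaussian 0 Γ) := by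
  rw [← clm₁_apply_eq_dot]
  exact fderiv_block_neg_log_apply hΓ hΓop Y hUd hU'c hκ₀ hκ₁ ha hτ hδ hθ1 hκθ hstab hU'b ψ₀ v

/-- **THE EXTRACTED QUADRATIC PART OF A BLOCK INPUT IS THE MATRIX `K_D(ψ₀)`, AND ITS FORM IS THE COVARIANCE FORMULA**: under (403)'s
hypotheses, for every direction `v`, `vᵀK_D(ψ₀)v = Z⁻¹∫e^{−U}(U″(ω+ψ₀)[v,v] − U′(ω+ψ₀)[v]²) + Z⁻²(∫e^{−U}U′(ω+ψ₀)[v])²`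
(`= ⟨U″[v,v]⟩_ν − Var_ν(U′[v])`). [folklore] -/
theorem blockHessianMatrix_apply (hΓ : Γ.PosSemidef) (hΓop : (γop • (1 : Matrix ι ι ℝ) - Γ).PosSemidef) (Y : Finset ι)
    (hUd : ∀ φ : EuclideanSpace ℝ ι, HasFDerivAt U (U' φ) φ) (hU'd : ∀ φ : EuclideanSpace ℝ ι, HasFDerivAt U' (U'' φ) φ)
    (hU''c : Continuous U'') (hκ₀ : 0 ≤ κ₀) (hκ₁ : 0 ≤ κ₁) (ha : 0 ≤ a) (hκ₂ : 0 ≤ κ₂) (hτ : 0 < τ) (hδ : 0 < δ) (hθ1 : θ < 1)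
    (hκθ : (2 * κ₀ * (1 + τ) + 4 * δ) * γop ≤ θ) (hstab : ∀ φ : EuclideanSpace ℝ ι, -(κ₀ * ∑ x ∈ Y, φ x ^ 2) ≤ U φ)
    (hU'b : ∀ φ : EuclideanSpace ℝ ι, ‖U' φ‖ ≤ κ₁ * (a + ∑ x ∈ Y, φ x ^ 2)) (hU''b : ∀ φ : EuclideanSpace ℝ ι, ‖U'' φ‖ ≤ κ₂)
    (ψ₀ v : EuclideanSpace ℝ ι) :
    (WithLp.ofLp v) ⬝ᵥ (Matrix.of fun x y : ι => (((∫ ω : EuclideanSpace ℝ ι, exp (-U (ω + ψ₀)) ∂(multivariateGaussian 0 Γ))⁻¹ • (∫ ω : EuclideanSpace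
      ℝ ι, exp (-U (ω + ψ₀)) • (U'' (ω + ψ₀) - (U' (ω + ψ₀)).smulRight (U' (ω + ψ₀))) ∂(multivariateGaussian 0 Γ)) + (((∫ ω : EuclideanSpace ℝ ι, exp
      (-U (ω + ψ₀)) ∂(multivariateGaussian 0 Γ)) ^ 2)⁻¹ • ∫ ω : EuclideanSpace ℝ ι, exp (-U (ω + ψ₀)) • U' (ω + ψ₀) ∂(multivariateGaussian 0
      Γ)).smulRight (∫ ω : EuclideanSpace ℝ ι, exp (-U (ω + ψ₀)) • U' (ω + ψ₀) ∂(multivariateGaussian 0 Γ))) (EuclideanSpace.single x (1 : ℝ))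
      (EuclideanSpace.single y (1 : ℝ)) + ((∫ ω : EuclideanSpace ℝ ι, exp (-U (ω + ψ₀)) ∂(multivariateGaussian 0 Γ))⁻¹ • (∫ ω : EuclideanSpace ℝ ι,
      exp (-U (ω + ψ₀)) • (U'' (ω + ψ₀) - (U' (ω + ψ₀)).smulRight (U' (ω + ψ₀))) ∂(multivariateGaussian 0 Γ)) + (((∫ ω : EuclideanSpace ℝ ι, exp (-U
      (ω + ψ₀)) ∂(multivariateGaussian 0 Γ)) ^ 2)⁻¹ • ∫ ω : EuclideanSpace ℝ ι, exp (-U (ω + ψ₀)) • U' (ω + ψ₀) ∂(multivariateGaussian 0 Γ)).smulRight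
      (∫ ω : EuclideanSpace ℝ ι, exp (-U (ω + ψ₀)) • U' (ω + ψ₀) ∂(multivariateGaussian 0 Γ))) (EuclideanSpace.single y (1 : ℝ))
      (EuclideanSpace.single x (1 : ℝ))) / 2) *ᵥ (WithLp.ofLp v) =
      (∫ ω : EuclideanSpace ℝ ι, exp (-U (ω + ψ₀)) ∂(multivariateGaussian 0 Γ))⁻¹ * ∫ ω : EuclideanSpace ℝ ι, exp (-U (ω + ψ₀)) * (U'' (ω + ψ₀) v v -
        U' (ω + ψ₀) v * U' (ω + ψ₀) v) ∂(multivariateGaussian 0 Γ) + (((∫ ω : EuclideanSpace ℝ ι, exp (-U (ω + ψ₀)) ∂(multivariateGaussian 0 Γ)) ^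
        2)⁻¹ * ((∫ ω : EuclideanSpace ℝ ι, exp (-U (ω + ψ₀)) * U' (ω + ψ₀) v ∂(multivariateGaussian 0 Γ)) * ∫ ω : EuclideanSpace ℝ ι, exp (-U (ω +
        ψ₀)) * U' (ω + ψ₀) v ∂(multivariateGaussian 0 Γ))) := by
  rw [symmMatrix_form_eq]
  exact hessian_block_neg_log_apply hΓ hΓop Y hUd hU'd hU''c hκ₀ hκ₁ ha hκ₂ hτ hδ hθ1 hκθ hstab hU'b hU''b ψ₀ v v

/-- **THE END — THE MATRIX LETTERS OF THE EXTRACTED QUADRATIC PART OF A BLOCK-LOCAL INPUT.**  Over `N(0,M⁻¹)` with `M ≻ 0` of floor `m`,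
`M⁻¹ ⪯ γ_op·1`, a `C²` block potential `U` with the three block letters, the two-point upper letter of constant `Λ ≥ 0` and the secant lower
letter of constant `λ ≥ 0` with `2λ ≤ m`, the regulator margins: at EVERY `ψ₀` the symmetrised Hessian matrix `K_D(ψ₀)` (which represents the
Hessian, `vᵀK_Dv = Hess(−log Z)(ψ₀)[v,v]`, by `symmMatrix_form_eq` ∕ `blockHessianMatrix_apply`) is symmetric and `K_D + 2λ·1 ⪰ 0`,
`Λ·1 − K_D ⪰ 0`. [folklore] -/
theorem blockHessianMatrix_letters {M : Matrix ι ι ℝ} {m lam Λ : ℝ} (hM : M.PosDef)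
    (hfl : ∀ z : ι → ℝ, m * ∑ i, z i ^ 2 ≤ z ⬝ᵥ (M *ᵥ z)) (hΓop : (γop • (1 : Matrix ι ι ℝ) - M⁻¹).PosSemidef) (Y : Finset ι)
    (hUd : ∀ φ : EuclideanSpace ℝ ι, HasFDerivAt U (U' φ) φ) (hU'd : ∀ φ : EuclideanSpace ℝ ι, HasFDerivAt U' (U'' φ) φ)
    (hU''c : Continuous U'') (hκ₀ : 0 ≤ κ₀) (hκ₁ : 0 ≤ κ₁) (ha : 0 ≤ a) (hκ₂ : 0 ≤ κ₂) (hτ : 0 < τ) (hδ : 0 < δ) (hθ0 : 0 < θ)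
    (hθ1 : θ < 1) (hκθ : (2 * κ₀ * (1 + τ) + 4 * δ) * γop ≤ θ) (hstab : ∀ φ : EuclideanSpace ℝ ι, -(κ₀ * ∑ x ∈ Y, φ x ^ 2) ≤ U φ)
    (hU'b : ∀ φ : EuclideanSpace ℝ ι, ‖U' φ‖ ≤ κ₁ * (a + ∑ x ∈ Y, φ x ^ 2)) (hU''b : ∀ φ : EuclideanSpace ℝ ι, ‖U'' φ‖ ≤ κ₂) (hΛ : 0 ≤ Λ)
    (hwup : ∀ φ φ' : EuclideanSpace ℝ ι, U φ' ≤ U φ + U' φ (φ' - φ) + Λ / 2 * ∑ x ∈ Y, (φ' x - φ x) ^ 2) (hlam : 0 ≤ lam)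
    (hUsec : ∀ s : ℝ, 0 ≤ s → s ≤ 1 → ∀ a b : EuclideanSpace ℝ ι,
      U ((1 - s) • a + s • b) - lam / 2 * (s * (1 - s)) * ∑ i, (a i - b i) ^ 2 ≤ (1 - s) * U a + s * U b)
    (hm : 2 * lam ≤ m) (ψ₀ : EuclideanSpace ℝ ι) :
    (Matrix.of fun x y : ι => (((∫ ω : EuclideanSpace ℝ ι, exp (-U (ω + ψ₀)) ∂(multivariateGaussian 0 M⁻¹))⁻¹ • (∫ ω : EuclideanSpace ℝ ι, exp (-U (ω
      + ψ₀)) • (U'' (ω + ψ₀) - (U' (ω + ψ₀)).smulRight (U' (ω + ψ₀))) ∂(multivariateGaussian 0 M⁻¹)) + (((∫ ω : EuclideanSpace ℝ ι, exp (-U (ω + ψ₀))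
      ∂(multivariateGaussian 0 M⁻¹)) ^ 2)⁻¹ • ∫ ω : EuclideanSpace ℝ ι, exp (-U (ω + ψ₀)) • U' (ω + ψ₀) ∂(multivariateGaussian 0 M⁻¹)).smulRight (∫ ω
      : EuclideanSpace ℝ ι, exp (-U (ω + ψ₀)) • U' (ω + ψ₀) ∂(multivariateGaussian 0 M⁻¹))) (EuclideanSpace.single x (1 : ℝ)) (EuclideanSpace.single y
      (1 : ℝ)) + ((∫ ω : EuclideanSpace ℝ ι, exp (-U (ω + ψ₀)) ∂(multivariateGaussian 0 M⁻¹))⁻¹ • (∫ ω : EuclideanSpace ℝ ι, exp (-U (ω + ψ₀)) • (U''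
      (ω + ψ₀) - (U' (ω + ψ₀)).smulRight (U' (ω + ψ₀))) ∂(multivariateGaussian 0 M⁻¹)) + (((∫ ω : EuclideanSpace ℝ ι, exp (-U (ω + ψ₀))
      ∂(multivariateGaussian 0 M⁻¹)) ^ 2)⁻¹ • ∫ ω : EuclideanSpace ℝ ι, exp (-U (ω + ψ₀)) • U' (ω + ψ₀) ∂(multivariateGaussian 0 M⁻¹)).smulRight (∫ ω
      : EuclideanSpace ℝ ι, exp (-U (ω + ψ₀)) • U' (ω + ψ₀) ∂(multivariateGaussian 0 M⁻¹))) (EuclideanSpace.single y (1 : ℝ)) (EuclideanSpace.single x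
      (1 : ℝ))) / 2).IsHermitian ∧
      ((Matrix.of fun x y : ι => (((∫ ω : EuclideanSpace ℝ ι, exp (-U (ω + ψ₀)) ∂(multivariateGaussian 0 M⁻¹))⁻¹ • (∫ ω : EuclideanSpace ℝ ι, exp (-U
        (ω + ψ₀)) • (U'' (ω + ψ₀) - (U' (ω + ψ₀)).smulRight (U' (ω + ψ₀))) ∂(multivariateGaussian 0 M⁻¹)) + (((∫ ω : EuclideanSpace ℝ ι, exp (-U (ω +
        ψ₀)) ∂(multivariateGaussian 0 M⁻¹)) ^ 2)⁻¹ • ∫ ω : EuclideanSpace ℝ ι, exp (-U (ω + ψ₀)) • U' (ω + ψ₀) ∂(multivariateGaussian 0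
        M⁻¹)).smulRight (∫ ω : EuclideanSpace ℝ ι, exp (-U (ω + ψ₀)) • U' (ω + ψ₀) ∂(multivariateGaussian 0 M⁻¹))) (EuclideanSpace.single x (1 : ℝ))
        (EuclideanSpace.single y (1 : ℝ)) + ((∫ ω : EuclideanSpace ℝ ι, exp (-U (ω + ψ₀)) ∂(multivariateGaussian 0 M⁻¹))⁻¹ • (∫ ω : EuclideanSpace ℝ
        ι, exp (-U (ω + ψ₀)) • (U'' (ω + ψ₀) - (U' (ω + ψ₀)).smulRight (U' (ω + ψ₀))) ∂(multivariateGaussian 0 M⁻¹)) + (((∫ ω : EuclideanSpace ℝ ι,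
        exp (-U (ω + ψ₀)) ∂(multivariateGaussian 0 M⁻¹)) ^ 2)⁻¹ • ∫ ω : EuclideanSpace ℝ ι, exp (-U (ω + ψ₀)) • U' (ω + ψ₀) ∂(multivariateGaussian 0
        M⁻¹)).smulRight (∫ ω : EuclideanSpace ℝ ι, exp (-U (ω + ψ₀)) • U' (ω + ψ₀) ∂(multivariateGaussian 0 M⁻¹))) (EuclideanSpace.single y (1 : ℝ))
        (EuclideanSpace.single x (1 : ℝ))) / 2) + (2 * lam) • (1 : Matrix ι ι ℝ)).PosSemidef ∧
      (Λ • (1 : Matrix ι ι ℝ) - (Matrix.of fun x y : ι => (((∫ ω : EuclideanSpace ℝ ι, exp (-U (ω + ψ₀)) ∂(multivariateGaussian 0 M⁻¹))⁻¹ • (∫ ω :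
        EuclideanSpace ℝ ι, exp (-U (ω + ψ₀)) • (U'' (ω + ψ₀) - (U' (ω + ψ₀)).smulRight (U' (ω + ψ₀))) ∂(multivariateGaussian 0 M⁻¹)) + (((∫ ω :
        EuclideanSpace ℝ ι, exp (-U (ω + ψ₀)) ∂(multivariateGaussian 0 M⁻¹)) ^ 2)⁻¹ • ∫ ω : EuclideanSpace ℝ ι, exp (-U (ω + ψ₀)) • U' (ω + ψ₀)
        ∂(multivariateGaussian 0 M⁻¹)).smulRight (∫ ω : EuclideanSpace ℝ ι, exp (-U (ω + ψ₀)) • U' (ω + ψ₀) ∂(multivariateGaussian 0 M⁻¹)))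
        (EuclideanSpace.single x (1 : ℝ)) (EuclideanSpace.single y (1 : ℝ)) + ((∫ ω : EuclideanSpace ℝ ι, exp (-U (ω + ψ₀)) ∂(multivariateGaussian 0
        M⁻¹))⁻¹ • (∫ ω : EuclideanSpace ℝ ι, exp (-U (ω + ψ₀)) • (U'' (ω + ψ₀) - (U' (ω + ψ₀)).smulRight (U' (ω + ψ₀))) ∂(multivariateGaussian 0 M⁻¹))
        + (((∫ ω : EuclideanSpace ℝ ι, exp (-U (ω + ψ₀)) ∂(multivariateGaussian 0 M⁻¹)) ^ 2)⁻¹ • ∫ ω : EuclideanSpace ℝ ι, exp (-U (ω + ψ₀)) • U' (ω +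
        ψ₀) ∂(multivariateGaussian 0 M⁻¹)).smulRight (∫ ω : EuclideanSpace ℝ ι, exp (-U (ω + ψ₀)) • U' (ω + ψ₀) ∂(multivariateGaussian 0 M⁻¹)))
        (EuclideanSpace.single y (1 : ℝ)) (EuclideanSpace.single x (1 : ℝ))) / 2)).PosSemidef := by
  have hΓ : (M⁻¹).PosSemidef := hM.inv.posSemidef
  set L : EuclideanSpace ℝ ι →L[ℝ] EuclideanSpace ℝ ι →L[ℝ] ℝ :=
    ((∫ ω : EuclideanSpace ℝ ι, exp (-U (ω + ψ₀)) ∂(multivariateGaussian 0 M⁻¹))⁻¹ • (∫ ω : EuclideanSpace ℝ ι, exp (-U (ω + ψ₀)) • (U'' (ω + ψ₀) -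
      (U' (ω + ψ₀)).smulRight (U' (ω + ψ₀))) ∂(multivariateGaussian 0 M⁻¹)) + (((∫ ω : EuclideanSpace ℝ ι, exp (-U (ω + ψ₀)) ∂(multivariateGaussian 0
      M⁻¹)) ^ 2)⁻¹ • ∫ ω : EuclideanSpace ℝ ι, exp (-U (ω + ψ₀)) • U' (ω + ψ₀) ∂(multivariateGaussian 0 M⁻¹)).smulRight (∫ ω : EuclideanSpace ℝ ι, exp
      (-U (ω + ψ₀)) • U' (ω + ψ₀) ∂(multivariateGaussian 0 M⁻¹))) with hL
  have hherm := symmMatrix_isHermitian (fun x y : ι => L (EuclideanSpace.single x (1 : ℝ)) (EuclideanSpace.single y (1 : ℝ)))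
  have hform : ∀ z : ι → ℝ, z ⬝ᵥ (Matrix.of fun x y : ι => (L (EuclideanSpace.single x (1 : ℝ)) (EuclideanSpace.single y (1 : ℝ)) +
      L (EuclideanSpace.single y (1 : ℝ)) (EuclideanSpace.single x (1 : ℝ))) / 2) *ᵥ z =
      L (WithLp.toLp 2 z) (WithLp.toLp 2 z) := fun z => symmMatrix_form_eq L (WithLp.toLp 2 z)
  refine ⟨hherm, letters_of_form_bounds hherm (fun z => ?_) (fun z => ?_)⟩
  · rw [hform z, hL]
    have hge := hessian_block_neg_log_ge hM hfl hΓop Y hUd hU'd hU''c hκ₀ hκ₁ ha hκ₂ hτ hδ hθ0 hθ1 hκθ hstab hU'b hU''b hlam hUsec hm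
      ψ₀ (WithLp.toLp 2 z)
    have e : ∑ i, (WithLp.toLp 2 z : EuclideanSpace ℝ ι) i ^ 2 = z ⬝ᵥ z := sum_sq_univ_eq_dotSelf z
    rw [e] at hge
    linarith
  · rw [hform z, hL]
    have hle := hessian_block_neg_log_le hΓ hΓop Y hUd hU'd hU''c hκ₀ hκ₁ ha hκ₂ hτ hδ hθ0 hθ1 hκθ hstab hU'b hU''b hwup ψ₀
      (WithLp.toLp 2 z)
    have hQ : ∑ x ∈ Y, (WithLp.toLp 2 z : EuclideanSpace ℝ ι) x ^ 2 ≤ z ⬝ᵥ z := sum_sq_le_dotSelf Y z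
    exact hle.trans (mul_le_mul_of_nonneg_left hQ hΛ)

end Road

/-! ## §3. Toy -/

/-- Toy (§1): on the empty site set the bound `Σ_∅ v² ≤ v·v` is `0 ≤ v·v`. -/
example (v : ι → ℝ) : ∑ x ∈ (∅ : Finset ι), v x ^ 2 ≤ v ⬝ᵥ v := sum_sq_le_dotSelf ∅ v

end Summit.QuantumFields.BalabanUV.T4Continuum.NE7b.SupBlockNextHessianMatrix
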